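import Mathlib
import HarnessLib
import Summits.NavierStokesRegularity.NavierStokesRegularity.Theorems.PoloidalWindowDoorLrcModEntireSheetTransport

/-!
# Route `PoloidalWindowDoor`, item `LrcModEntire` (stmt-NavierStokesRegularity-20428), cell (Q4-sonic, straight branch, μ(−1,0) < 0) —
# THE CUBIC TRANSPORT LAW ON A CHARACTERISTIC SHEET: the `s`-variation of the transversal cubic `∂_ν³θ` is carried rigidly along the sheet

Cell ns-regularity-ideate, LEAD-lineage seat ns-poloidal-K2-p3 g17 (`--supports stmt-NavierStokesRegularity-20428`; memo
`Cruxes/LrcModEntire/T2B-g16.md` §5 and the LEAD g17 note `T2B-g17.md`).  Order-three twin of `…SheetTransport.transport_on_characteristic_sheet`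
(p731983: `∂_z(d′·(∂_ν²θ)²) = 0`).

Setting (class-free): `θ : ℝ³ → ℝ` smooth with the slice law `∂₂²θ = −μ(x₂)Δₕθ` on the slab `{x₂ ∈ I}`, a horizontal unit vector `e`, `ν = Je`,
the parallel straight web `W(s,z) = s·e + d(z)·Je + z·e₂` of `ν`-critical points of `θ`, and the sheet CHARACTERISTIC: `d′(z)² + μ(z) = 0` on `I`.
Write `a₂(s,z) = D²θ(W(s,z))[ν][ν]` and `a₃(s,z) = ∂_ν(D²θ[ν][ν])(W(s,z))` (the transversal cubic).  In the sheared flattened coordinates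
`H(s,n,z) = θ(s·e + (n + d(z))·Je + z·e₂)` the slice law is `H_zz − 2d′H_nz − d″H_n + (d′² + μ)H_nn + μH_ss = 0`
(`…SheetFlattenTools.sheetOp_shear_eq_zero`); it commutes with `∂_n` (`…SheetCauchyUniqueness.sheetOp_pdN_eq_zero`), so `H_nn` solves it too, and on
the sheet `{n = 0}` — where `H_nn = a₂`, `∂_nH_nn = a₃` and the `H_nn`-coefficient `d′² + μ` vanishes — it reads

* `cubic_transport_law` — **`2d′(z)·∂_z a₃(s,z) + d″(z)·a₃(s,z) + μ(z)·∂_s²a₂(s,z) = ∂_z²a₂(s,z)`** (all derivatives along the sheet, for every `s`).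

If moreover the transversal Hessian is homogeneous along the web (`a₂(s,z) = a₂(s′,z)`: the ridge law of cell (Q4), `Δₕθ|_web = −κ(z)` with
`D²θ[e][·] = 0` on the hot sheet), the right side and the `∂_s²` term do not depend on `s`, so the DIFFERENCE `D = a₃(s,·) − a₃(s′,·)` solves the
homogeneous transport equation `2d′D′ + d″D = 0`, i.e.

* `cubic_transport_conserved` — **`HasDerivAt (z ↦ d′(z)·(a₃(s,z) − a₃(s′,z))²) 0 z`** for all `s, s′` and `z ∈ I`:

the `s`-dependence of the transversal cubic is a FIXED function `A₃(s)` transported along the height with the weight `√|d′|`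
(`√d′·a₃(s,z) = A₃(s) + Φ₃(z)`, memo T2B-g16 §5(B)).  This is the first datum on the sonic hot sheet that may depend on `s` (the 2-jet of `∂_eθ` and
`D³θ[e][·][·]` vanish there: `…Q4SonicHotSheetJet`); the law says its `s`-profile is the same at every height of the window.

WHAT THIS IS NOT: not a claim about Navier–Stokes regularity and not a stub of the registry; class-free calculus for the residual research cell
`stub_Q4sonicLineNeg` of `Cruxes/LrcModEntire/Lines/twist_split.lean` (bears_on LADDER-NS N0 via item 20428).
-/

noncomputable section

set_option linter.dupNamespace false

namespace Summit.NavierStokesRegularity.NavierStokesRegularity.Theorems.PoloidalWindowDoorLrcModEntireSheetTransportCubic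

open Set Function Filter Topology Metric
open scoped ContDiff
open Summit.NavierStokesRegularity.NavierStokesRegularity.Theorems.PoloidalWindowDoorLrcModEntireSheetCauchyUniqueness
open Summit.NavierStokesRegularity.NavierStokesRegularity.Theorems.PoloidalWindowDoorLrcModEntireSheetFlattenTools
open Summit.NavierStokesRegularity.NavierStokesRegularity.Theorems.PoloidalWindowDoorLrcModEntireSheetTransport

/-! ### Two small tools on the sheet `{n = 0}` -/

/-- If two `z`-lines of the sheet carry the same values of `K` on the open height window, they carry the same `∂_zK`. -/
theorem pd_eZ_eq_of_sheet_eq {I : Set ℝ} (hI : IsOpen I) {K : ℝ × ℝ × ℝ → ℝ} (hK : ContDiffOn ℝ ∞ K (slab I))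
    {s s' : ℝ} (h : ∀ z ∈ I, K (s, 0, z) = K (s', 0, z)) {z : ℝ} (hz : z ∈ I) :
    pd eZ K (s, 0, z) = pd eZ K (s', 0, z) := by
  have h1 : HasDerivAt (fun z' : ℝ => K (s, 0, z')) (pd eZ K (s, 0, z)) z := hasDerivAt_sheet_line hI hK s hz
  have h2 : HasDerivAt (fun z' : ℝ => K (s', 0, z')) (pd eZ K (s', 0, z)) z := hasDerivAt_sheet_line hI hK s' hz
  have heq : (fun z' : ℝ => K (s, 0, z')) =ᶠ[𝓝 z] fun z' : ℝ => K (s', 0, z') := by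
    filter_upwards [hI.mem_nhds hz] with z' hz' using h z' hz'
  exact (h1.congr_of_eventuallyEq heq.symm).unique h2

/-- Third derivatives of the flattened field `Θ = θ ∘ L_e`: `∂_u∂_w∂_vΘ(p) = D(x ↦ D(y ↦ Dθ(y)[Lv])(x)[Lw])(Lp)[Lu]`. -/
theorem pd_pd_pd_comp_frame {θ : EuclideanSpace ℝ (Fin 3) → ℝ} (hθ : ContDiff ℝ 3 θ) (e : EuclideanSpace ℝ (Fin 3))
    (u w v p : ℝ × ℝ × ℝ) :
    pd u (pd w (pd v (fun q => θ (frameCLM e q)))) p =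
      fderiv ℝ (fun x => fderiv ℝ (fun y => fderiv ℝ θ y (frameCLM e v)) x (frameCLM e w)) (frameCLM e p) (frameCLM e u) := by
  have hθ2 : ContDiff ℝ 2 θ := hθ.of_le (by norm_num)
  have hfun : pd w (pd v (fun q => θ (frameCLM e q))) =
      fun q => (fun x => fderiv ℝ (fun y => fderiv ℝ θ y (frameCLM e v)) x (frameCLM e w)) (frameCLM e q) :=
    funext fun q => pd_pd_comp_frame hθ2 e w v q
  rw [hfun]
  -- the function `x ↦ D(y ↦ Dθ(y)[Lv])(x)[Lw]` is differentiable (`θ ∈ C³`)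
  have hg1 : ContDiff ℝ 2 (fun y => fderiv ℝ θ y (frameCLM e v)) :=
    (hθ.fderiv_right (m := 2) (by norm_num)).clm_apply contDiff_const
  have hg : Differentiable ℝ (fun x => fderiv ℝ (fun y => fderiv ℝ θ y (frameCLM e v)) x (frameCLM e w)) :=
    ((hg1.fderiv_right (m := 1) (by norm_num)).differentiable (by norm_num)).clm_apply (differentiable_const _)
  exact pd_comp_frame hg e u p

/-! ### The cubic transport law -/

section Law

variable {θ : EuclideanSpace ℝ (Fin 3) → ℝ} {I : Set ℝ} {μ d : ℝ → ℝ} {e : EuclideanSpace ℝ (Fin 3)}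

/-- **THE CUBIC TRANSPORT LAW ON A CHARACTERISTIC SHEET (with its `s`-homogeneous source).**  `θ` smooth with the slice law on the slab `{x₂ ∈ I}`,
`e` a horizontal unit vector, `d` smooth on `I`, every web point `s·e + d(z)·Je + z·e₂` critical for `θ` in the direction `Je`, the transversal Hessian
`D²θ(web point)[Je][Je]` independent of `s`, and the sheet characteristic (`d′² + μ = 0` on `I`).  Then for all `s, s′` and `z ∈ I` the function
`z ↦ d′(z)·(a₃(s,z) − a₃(s′,z))²`, `a₃(s,z) = ∂_{Je}(D²θ[Je][Je])(s·e + d(z)·Je + z·e₂)`, has derivative `0` at `z`. -/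
theorem cubic_transport_conserved (hθ : ContDiff ℝ ∞ θ) (hI : IsOpen I) (hμ : ∀ z ∈ I, DifferentiableAt ℝ μ z)
    (hd : ContDiffOn ℝ ∞ d I) (he2 : e 2 = 0) (hunit : e 0 ^ 2 + e 1 ^ 2 = 1)
    (hlaw : ∀ x : EuclideanSpace ℝ (Fin 3), x 2 ∈ I →
      fderiv ℝ (fun y => fderiv ℝ θ y (EuclideanSpace.single 2 (1 : ℝ))) x (EuclideanSpace.single 2 (1 : ℝ)) =
        -μ (x 2) * (fderiv ℝ (fun y => fderiv ℝ θ y (EuclideanSpace.single 0 (1 : ℝ))) x (EuclideanSpace.single 0 (1 : ℝ)) +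
          fderiv ℝ (fun y => fderiv ℝ θ y (EuclideanSpace.single 1 (1 : ℝ))) x (EuclideanSpace.single 1 (1 : ℝ))))
    (hweb : ∀ s : ℝ, ∀ z ∈ I, fderiv ℝ θ (s • e + d z • Jvec e + z • e2) (Jvec e) = 0)
    (hhom : ∀ s s' : ℝ, ∀ z ∈ I,
      fderiv ℝ (fderiv ℝ θ) (s • e + d z • Jvec e + z • e2) (Jvec e) (Jvec e) =
        fderiv ℝ (fderiv ℝ θ) (s' • e + d z • Jvec e + z • e2) (Jvec e) (Jvec e))
    (hQ0 : ∀ z ∈ I, deriv d z ^ 2 + μ z = 0) (s s' : ℝ) {z : ℝ} (hz : z ∈ I) :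
    HasDerivAt (fun z' : ℝ => deriv d z' *
      (fderiv ℝ (fun x => fderiv ℝ (fderiv ℝ θ) x (Jvec e) (Jvec e)) (s • e + d z' • Jvec e + z' • e2) (Jvec e) -
        fderiv ℝ (fun x => fderiv ℝ (fderiv ℝ θ) x (Jvec e) (Jvec e)) (s' • e + d z' • Jvec e + z' • e2) (Jvec e)) ^ 2) 0 z := by
  -- smoothness and the flattened field
  have hθ2 : ContDiff ℝ 2 θ := hθ.of_le (by norm_cast)
  have hθ3 : ContDiff ℝ 3 θ := hθ.of_le (by norm_cast)
  have hθd : Differentiable ℝ θ := hθ.differentiable (by simp)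
  set Θ : ℝ × ℝ × ℝ → ℝ := fun q => θ (frameCLM e q) with hΘ
  have hΘs : ContDiff ℝ ∞ Θ := hθ.comp (frameCLM e).contDiff
  have hΘon : ContDiffOn ℝ ∞ Θ (slab I) := hΘs.contDiffOn
  have hΘpde : ∀ p ∈ slab I, sheetOp (fun _ => 0) (fun _ => 0) μ μ Θ p = 0 :=
    sheetOp_frame_eq_zero hθ2 hlaw he2 hunit
  -- the sheared field and its equation
  set H : ℝ × ℝ × ℝ → ℝ := fun q => Θ (shear d q) with hH
  have hHpde := sheetOp_shear_eq_zero hI hΘs hΘpde hd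
  have hHs : ContDiffOn ℝ ∞ H (slab I) := contDiffOn_shear hI hΘs hd
  -- derivatives of `d`
  have hdd : ∀ z ∈ I, DifferentiableAt ℝ d z := fun z hz =>
    (hd.contDiffAt (hI.mem_nhds hz)).differentiableAt (by simp)
  have hd1 : ContDiffOn ℝ ∞ (deriv d) I := hd.deriv_of_isOpen hI (m := ∞) (by simp)
  have hdd1 : ∀ z ∈ I, DifferentiableAt ℝ (deriv d) z := fun z hz =>
    (hd1.contDiffAt (hI.mem_nhds hz)).differentiableAt (by simp)
  have hd2 : ContDiffOn ℝ ∞ (deriv (deriv d)) I := hd1.deriv_of_isOpen hI (m := ∞) (by simp)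
  have hdd2 : ∀ z ∈ I, DifferentiableAt ℝ (deriv (deriv d)) z := fun z hz =>
    (hd2.contDiffAt (hI.mem_nhds hz)).differentiableAt (by simp)
  have hA : ∀ z ∈ I, DifferentiableAt ℝ (fun z => -2 * deriv d z) z := fun z hz => (hdd1 z hz).const_mul _
  have hB : ∀ z ∈ I, DifferentiableAt ℝ (fun z => -(deriv (deriv d) z)) z := fun z hz => (hdd2 z hz).neg
  have hQd : ∀ z ∈ I, DifferentiableAt ℝ (fun z => deriv d z ^ 2 + μ z) z := fun z hz =>
    ((hdd1 z hz).pow 2).add (hμ z hz)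
  -- `K₂ = ∂_n H` and `K₃ = ∂_n K₂` solve the sheared equation
  set K₂ : ℝ × ℝ × ℝ → ℝ := pd eN H with hK₂
  have hK₂s : ContDiffOn ℝ ∞ K₂ (slab I) := contDiffOn_pd hI hHs eN
  have hK₂pde := sheetOp_pdN_eq_zero hI hA hB hQd hμ hHs hHpde
  set K₃ : ℝ × ℝ × ℝ → ℝ := pd eN K₂ with hK₃
  have hK₃s : ContDiffOn ℝ ∞ K₃ (slab I) := contDiffOn_pd hI hK₂s eN
  have hK₃pde := sheetOp_pdN_eq_zero hI hA hB hQd hμ hK₂s hK₂pde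
  -- geometry of the sheet
  have hshear0 : ∀ s z : ℝ, shear d (s, 0, z) = (s, d z, z) := fun s z => by simp [shear]
  have hframe : ∀ s m z : ℝ, frameCLM e (s, m, z) = s • e + m • Jvec e + z • e2 := fun s m z => by
    rw [frameCLM_apply]
  -- `K₂ = (∂_nΘ) ∘ Ψ`, `K₃ = (∂_n∂_nΘ) ∘ Ψ`, `∂_nK₃ = (∂_n∂_n∂_nΘ) ∘ Ψ` on the slab
  have hNΘs : ContDiffOn ℝ ∞ (pd eN Θ) (slab I) := contDiffOn_pd hI hΘon eN
  have hNNΘs : ContDiffOn ℝ ∞ (pd eN (pd eN Θ)) (slab I) := contDiffOn_pd hI hNΘs eN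
  have hK₂eq : ∀ q ∈ slab I, K₂ q = pd eN Θ (shear d q) := fun q hq => by
    rw [hK₂, hH, pd_shear_eN hI hΘon hq (hdd q.2.2 hq)]
  have hK₃eq : ∀ q ∈ slab I, K₃ q = pd eN (pd eN Θ) (shear d q) := fun q hq => by
    rw [hK₃, pd_congr_on_slab hI eN hK₂eq hq, pd_shear_eN hI hNΘs hq (hdd q.2.2 hq)]
  have hK₄eq : ∀ q ∈ slab I, pd eN K₃ q = pd eN (pd eN (pd eN Θ)) (shear d q) := fun q hq => by
    rw [pd_congr_on_slab hI eN hK₃eq hq, pd_shear_eN hI hNNΘs hq (hdd q.2.2 hq)]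
  -- values on the sheet: `K₂ = 0`, `K₃ = a₂` (homogeneous in `s`), `∂_nK₃ = a₃`
  have hN : ∀ s : ℝ, ∀ z ∈ I, K₂ (s, 0, z) = 0 := by
    intro s z hz
    rw [hK₂eq _ (sheet_mem_slab s hz), hshear0, hΘ, pd_comp_frame hθd e eN, frameCLM_eN, hframe]
    exact hweb s z hz
  have hK₃val : ∀ s : ℝ, ∀ z ∈ I, K₃ (s, 0, z) = fderiv ℝ (fderiv ℝ θ) (s • e + d z • Jvec e + z • e2) (Jvec e) (Jvec e) := by
    intro s z hz
    rw [hK₃eq _ (sheet_mem_slab s hz), hshear0, hΘ, pd_pd_comp_frame hθ2 e eN eN, frameCLM_eN, hframe,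
      nested_eq_fderiv_fderiv hθ2]
  have hK₃hom : ∀ s s' : ℝ, ∀ z ∈ I, K₃ (s, 0, z) = K₃ (s', 0, z) := fun s s' z hz => by
    rw [hK₃val s z hz, hK₃val s' z hz]; exact hhom s s' z hz
  have ha₃ : ∀ s : ℝ, ∀ z ∈ I, pd eN K₃ (s, 0, z) =
      fderiv ℝ (fun x => fderiv ℝ (fderiv ℝ θ) x (Jvec e) (Jvec e)) (s • e + d z • Jvec e + z • e2) (Jvec e) := by
    intro s z hz
    rw [hK₄eq _ (sheet_mem_slab s hz), hshear0, hΘ, pd_pd_pd_comp_frame hθ3 e eN eN eN, frameCLM_eN, hframe]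
    have hfun : (fun x => fderiv ℝ (fun y => fderiv ℝ θ y (Jvec e)) x (Jvec e)) =
        fun x => fderiv ℝ (fderiv ℝ θ) x (Jvec e) (Jvec e) := funext fun x => nested_eq_fderiv_fderiv hθ2 x _ _
    rw [hfun]
  -- tangential second derivatives of `K₃` on the sheet: `∂_s²K₃ = 0`, `∂_z²K₃` independent of `s`
  have hSval : ∀ s : ℝ, ∀ z ∈ I, pd eS K₃ (s, 0, z) = 0 := by
    intro s z hz
    have hvan : ∀ s'' : ℝ, (fun q : ℝ × ℝ × ℝ => K₃ q - K₃ (0, 0, z)) (s'', 0, z) = 0 := fun s'' => by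
      simp only [hK₃hom s'' 0 z hz, sub_self]
    have hdK : DifferentiableAt ℝ K₃ (s, 0, z) := differentiableAt_of_slab hI hK₃s (sheet_mem_slab s hz)
    have h := pdS_eq_zero_of_vanish_on_line hvan (hdK.sub_const _)
    unfold pd at h ⊢
    rwa [fderiv_sub_const] at h
  have hSS : ∀ s : ℝ, ∀ z ∈ I, pd eS (pd eS K₃) (s, 0, z) = 0 := by
    intro s z hz
    exact pdS_eq_zero_of_vanish_on_line (fun s'' => hSval s'' z hz)
      (differentiableAt_of_slab hI (contDiffOn_pd hI hK₃s eS) (sheet_mem_slab s hz))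
  have hZs : ContDiffOn ℝ ∞ (pd eZ K₃) (slab I) := contDiffOn_pd hI hK₃s eZ
  have hZhom : ∀ z ∈ I, pd eZ K₃ (s, 0, z) = pd eZ K₃ (s', 0, z) := fun z hz =>
    pd_eZ_eq_of_sheet_eq hI hK₃s (fun z' hz' => hK₃hom s s' z' hz') hz
  have hZZhom : pd eZ (pd eZ K₃) (s, 0, z) = pd eZ (pd eZ K₃) (s', 0, z) :=
    pd_eZ_eq_of_sheet_eq hI hZs hZhom hz
  -- the two transport identities at `(s,0,z)` and `(s',0,z)` and their difference
  have htr : ∀ s'' : ℝ, pd eZ (pd eZ K₃) (s'', 0, z) + (-2 * deriv d z) * pd eZ (pd eN K₃) (s'', 0, z) +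
      (-(deriv (deriv d) z)) * pd eN K₃ (s'', 0, z) = 0 := by
    intro s''
    have h := hK₃pde (s'', 0, z) (sheet_mem_slab s'' hz)
    unfold sheetOp at h
    simp only at h
    rw [hSS s'' z hz, hQ0 z hz] at h
    linarith
  have hdiff : (-2 * deriv d z) * (pd eZ (pd eN K₃) (s, 0, z) - pd eZ (pd eN K₃) (s', 0, z)) +
      (-(deriv (deriv d) z)) * (pd eN K₃ (s, 0, z) - pd eN K₃ (s', 0, z)) = 0 := by
    have h1 := htr s
    have h2 := htr s'
    rw [hZZhom] at h1
    linarith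
  -- the difference `D(z') = ∂_nK₃(s,0,z') − ∂_nK₃(s',0,z')` and the conserved quantity `d′ D²`
  have hNs : ContDiffOn ℝ ∞ (pd eN K₃) (slab I) := contDiffOn_pd hI hK₃s eN
  have hD : HasDerivAt (fun z' : ℝ => pd eN K₃ (s, 0, z') - pd eN K₃ (s', 0, z'))
      (pd eZ (pd eN K₃) (s, 0, z) - pd eZ (pd eN K₃) (s', 0, z)) z :=
    (hasDerivAt_sheet_line hI hNs s hz).sub (hasDerivAt_sheet_line hI hNs s' hz)
  set Dv : ℝ := pd eN K₃ (s, 0, z) - pd eN K₃ (s', 0, z) with hDv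
  set Dd : ℝ := pd eZ (pd eN K₃) (s, 0, z) - pd eZ (pd eN K₃) (s', 0, z) with hDd
  have hprod : HasDerivAt (fun z' : ℝ => deriv d z' * (pd eN K₃ (s, 0, z') - pd eN K₃ (s', 0, z')) ^ 2)
      (deriv (deriv d) z * Dv ^ 2 + deriv d z * ((2 : ℕ) * Dv ^ (2 - 1) * Dd)) z :=
    (hdd1 z hz).hasDerivAt.mul (hD.pow 2)
  have hzero : deriv (deriv d) z * Dv ^ 2 + deriv d z * ((2 : ℕ) * Dv ^ (2 - 1) * Dd) = 0 := by
    norm_num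
    linear_combination (-Dv) * hdiff
  have hmain : HasDerivAt (fun z' : ℝ => deriv d z' * (pd eN K₃ (s, 0, z') - pd eN K₃ (s', 0, z')) ^ 2) 0 z :=
    hprod.congr_deriv hzero
  -- identify `∂_nK₃` on the sheet with the transversal cubic of `θ`, near `z`
  refine hmain.congr_of_eventuallyEq ?_
  filter_upwards [hI.mem_nhds hz] with z' hz'
  rw [ha₃ s z' hz', ha₃ s' z' hz']

end Law

end Summit.NavierStokesRegularity.NavierStokesRegularity.Theorems.PoloidalWindowDoorLrcModEntireSheetTransportCubic

end
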